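/-
Copyright: statement-level skeleton of a published paper (lit-balaban cell, Phase-2 proof seat p19, gen 5). No claims beyond
what the kernel checks below.
-/
import Mathlib
import Literature.MathematicalPhysics.QuantumFieldTheory.Balaban1983to89.B3AmpIBPSingle
import Literature.MathematicalPhysics.QuantumFieldTheory.Balaban1983to89.B3Prop21Except24

/-!
# B3 — T. Bałaban, *(Higgs)₂,₃ quantum fields in a finite volume. III. Renormalization*, CMP **88** (1983) 411–445
[Balaban1983Higgs3] — Proposition 2.1 pp. 424–428 WITH THE (2.4) EXCEPTION for ONE IBP-ready amplitude of the print-strength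
class `IBPAmp₁`: (1.33) for the sum with fixed ordering, for the total amplitude, and with the graph-uniform constant `O(1)(n̄)`

statement-level skeleton of published theorems with citation tags; proofs where landed; nothing here is a claim about
the Yang–Mills mass gap

PDF held: `paper:balaban1983-higgs-2-3-quantum-fields-finite-volume` (journal page = PDF page + 410); pp. 420–421, 424–428
[PDF 10–11, 14–18] read on the materialised text (`lit read … --pages 12-18`).

Part of the Phase-2 work on SKELETON rows **B3.Prop2.1 / B3.Prop2.2 / B3.Eq2.10** (unit `lit-balaban-p19` gen 5, HOME
`run/shared/lean/pub/lit-balaban/`): file 2 of the chain `B3AmpIBPSingle` → `B3Prop21Except24Single` (this file) →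
`B3IBPZeroBoxKernels` → `B3IBPZeroBox` (the IBP-readiness hypotheses of gen 4's `B3Prop21Except24.prop21_except24` DISCHARGED for
the zero-field box line class).  Sub-namespace `…Balaban1983to89.B3Ineq213`, new names only; no existing declaration is modified.

WHAT IS REPRODUCED.  Proposition 2.1 p. 424 [PDF 14], verbatim: *"Let G be a connected graph such that its each connected
subgraph, with the possible exception of the subgraphs (2.4), has a positive degree. Then we define G_ren = {G} and Proposition 1
holds in this case."*, by its printed proof pp. 424–428 — (2.6)/(2.7), the integration by parts (2.8)/(2.9) at the graphs (2.4)
along each ordering, (2.13), (2.15) — exactly as in gen 4's `B3Prop21Except24Ordering`/`B3Prop21Except24`, but for an amplitude of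
the PRINT-STRENGTH class `IBPAmp₁` of `B3AmpIBPSingle` (one derivative leg per vertex; the derivative budget (2.10) only for at most
one difference per propagator argument).  KERNEL-CHECKED HERE: relabeling along an ordering keeps the readiness (`IBPAmp₁.relabel`);
**(1.33) for the sum with fixed ordering l̃** when every component of the `G_i` along l̃ has positive degree OR is a (2.4)-block
(`IBPAmp₁.sum_abs_E_le_ordering`); **(1.33) for the total amplitude** (`IBPAmp₁.abs_Etot_le_except24`); and the graph-UNIFORM form
with gen 4's constant `O(1)(n̄) = unifO1x P (mbar n̄)` (p. 421: *"The constant O(1) depends on α₀, n̄"*): for an amplitude whose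
lattice constants are those of the family parameters `P`, with at most `mb` lines, kernel constants `≤ Cmax` and `cD ≤ CD`,
**`|E(G′)| ≤ unifO1x P mb · pref`** (`IBPAmp₁.abs_Etot_le_unifO1x`) — the inequality every family of such amplitudes assembles into
r15's `B3Prop1.Prop21` (done for the zero-field box class in `B3IBPZeroBox`).
-/

open Finset

namespace Literature.MathematicalPhysics.QuantumFieldTheory.Balaban1983to89.B3Ineq213

open B3Ineq215 B3Sect2FirstEstimate B3Prop1

variable {V : Type} [Fintype V] [DecidableEq V] {m : ℕ}

/-! ## Relabeling a print-strength IBP-ready amplitude along an ordering -/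

namespace IBPAmp₁

variable {G : Counts V m}

/-- The IBP-ready amplitude with its lines renumbered along the ordering l̃ = σ (`Amp.relabel` plus the readiness data carried
along; one derivative leg per vertex is a property of the vertices, unchanged). [cite: Balaban1983Higgs3, (2.7) p.425] -/
noncomputable def relabel (A : IBPAmp₁ G) (σ : Equiv.Perm (Fin m)) : IBPAmp₁ (relabelCounts G σ) where
  toAmp := A.toAmp.relabel σ
  dir := A.dir
  Kb := fun i => A.Kb (σ i)
  cD := A.cD
  one_le_cD := A.one_le_cD
  single := fun v i i' hne h1 => A.single v (σ i) (σ i') (fun h => hne (σ.injective h)) h1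
  K_eq := fun i hne hd t x y => A.K_eq (σ i) hne hd t x y
  Kb_le := fun i hne hd => A.Kb_le (σ i) hne hd
  u_face := fun i hne hd => A.u_face (σ i) hne hd
  du_le := fun i hne hd x => A.du_le (σ i) hne hd x
  KdX_le := fun i μ h => A.KdX_le (σ i) μ h
  KdY_le := fun i ν h => A.KdY_le (σ i) ν h
  KdXY_le := fun i μ ν hx hy => A.KdXY_le (σ i) μ ν hx hy

/-- Relabeling does not change the prefactor. [cite: Balaban1983Higgs3, (2.7) p.425] -/
theorem relabel_pref (A : IBPAmp₁ G) (σ : Equiv.Perm (Fin m)) : (A.relabel σ).toAmp.pref = A.toAmp.pref := rfl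

/-! ## (1.33) for the sum with fixed ordering, the (2.4)-blocks admitted -/

/-- **(1.33) for the sum with fixed ordering l̃, with the (2.4) exception, print-strength readiness**: if every component of the
subgraphs `G_1 ⊂ … ⊂ G_m` along σ has positive degree OR is a (2.4)-block, then `Σ_{j∈J(l̃)} |E(G(j), {□(v)}, Φ′, A)| ≤ #{G′∗} · (Π_l
C_l)(1+e^{δ₁})^{2m} · unifConst215(d, L, m, δ₁) · cD^m · pref` — (2.7), then (2.8)/(2.9) at the sites (`IBPAmp₁.E_eq_sum_terms`), then
(2.13) and (2.15) for each term `G′∗` (all of whose blocks have positive degree, `pos_moveCounts`). [cite: Balaban1983Higgs3, Prop. 2.1 p.426] -/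
theorem sum_abs_E_le_ordering (A : IBPAmp₁ G) (𝒜 : B3.Assignment m A.k) (σ : Equiv.Perm (Fin m))
    (hyp : ∀ i, i ≤ m → ∀ b ∈ (relabelCounts G σ).toModel.reps i, (relabelCounts G σ).toModel.Nontriv i b →
      Is24Block (relabelCounts G σ) i b ∨ 0 < (relabelCounts G σ).toModel.D i b) :
    ∑ j ∈ 𝒜.J σ, |A.E (fun l => ((j l : Fin A.k) : ℕ))|
      ≤ ((choices (relabelCounts G σ).src (relabelCounts G σ).tgt (sites (relabelCounts G σ))).card : ℝ)
        * (((∏ l, A.C l) * ((1 + Esh G.toModel) ^ 2) ^ m) * unifConst215 G.d G.L m G.δ₁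
          * (A.cD ^ m * A.toAmp.pref)) := by
  classical
  set Gs := relabelCounts G σ with hGs
  set As : IBPAmp₁ Gs := A.relabel σ with hAs
  set S := sites Gs with hSdef
  have hSsub : S ⊆ sites Gs := subset_refl _
  -- the reading of `j ∈ J(l̃)` along σ is a member of `Mon m k`, injectively
  have hmem : ∀ j ∈ 𝒜.J σ, (fun i => ((j (σ i) : Fin A.k) : ℕ)) ∈ Model.Mon m A.k :=
    fun j hj => Model.mem_Mon_of_orderedAlong (𝒜.ordered σ j hj)
  have hinj : Set.InjOn (fun (j : Fin m → Fin A.k) (i : Fin m) => ((j (σ i) : Fin A.k) : ℕ)) ↑(𝒜.J σ) := by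
    intro j _ j' _ h
    funext l
    have e := congrFun h (σ.symm l)
    simp only [Equiv.apply_symm_apply] at e
    exact Fin.ext e
  -- each term: (2.13) termwise and (2.15), all blocks positive
  have hterm : ∀ c : {c // c ∈ choices Gs.src Gs.tgt S},
      ∑ j' ∈ Model.Mon m A.k, |(As.term hSsub c.2).E j'|
        ≤ ((∏ l, A.C l) * ((1 + Esh G.toModel) ^ 2) ^ m) * unifConst215 G.d G.L m G.δ₁ * (A.cD ^ m * A.toAmp.pref) := by
    intro c
    set T := As.term hSsub c.2 with hT
    have hpos := pos_moveCounts Gs c.2 hyp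
    have hTk : T.k = A.k := rfl
    have h213 : ∀ j' ∈ Model.Mon m A.k, |T.E j'| ≤ (∏ q, T.C q) * T.pref * (moveCounts Gs S c.1).toModel.W 0 A.k j' T.box := by
      intro j' hj'
      exact T.abs_E_le hj'
    have hW : ∑ j' ∈ Model.Mon m A.k, (moveCounts Gs S c.1).toModel.W 0 A.k j' T.box
        ≤ (moveCounts Gs S c.1).toModel.const215 := (moveCounts Gs S c.1).toModel.ineq215_of_pos hpos A.k T.box
    have hconst : (moveCounts Gs S c.1).toModel.const215 ≤ unifConst215 G.d G.L m G.δ₁ :=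
      const215_le_unifConst215 (moveCounts Gs S c.1) hpos
    have hC : ∏ q, T.C q = (∏ l, A.C l) * ((1 + Esh G.toModel) ^ 2) ^ m := by
      rw [hT, As.term_prod_C hSsub c.2, ← A.toAmp.prod_C_relabel σ]
      rfl
    have hpref : T.pref ≤ A.cD ^ m * A.toAmp.pref := As.term_pref_le hSsub c.2
    have hC0 : 0 ≤ ∏ q, T.C q := prod_nonneg fun q _ => T.C_nonneg q
    have hP0 : 0 ≤ T.pref := T.pref_nonneg
    have hU0 : 0 ≤ unifConst215 G.d G.L m G.δ₁ := (unifConst215_pos G.d_pos G.two_le_L m G.δ₁_pos).le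
    calc ∑ j' ∈ Model.Mon m A.k, |T.E j'|
        ≤ ∑ j' ∈ Model.Mon m A.k, (∏ q, T.C q) * T.pref * (moveCounts Gs S c.1).toModel.W 0 A.k j' T.box :=
          sum_le_sum h213
      _ = (∏ q, T.C q) * T.pref * ∑ j' ∈ Model.Mon m A.k, (moveCounts Gs S c.1).toModel.W 0 A.k j' T.box := by
          rw [mul_sum]
      _ ≤ (∏ q, T.C q) * T.pref * unifConst215 G.d G.L m G.δ₁ :=
          mul_le_mul_of_nonneg_left (hW.trans hconst) (mul_nonneg hC0 hP0)
      _ ≤ (∏ q, T.C q) * (A.cD ^ m * A.toAmp.pref) * unifConst215 G.d G.L m G.δ₁ :=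
          mul_le_mul_of_nonneg_right (mul_le_mul_of_nonneg_left hpref hC0) hU0
      _ = _ := by rw [hC]; ring
  -- assemble
  calc ∑ j ∈ 𝒜.J σ, |A.E (fun l => ((j l : Fin A.k) : ℕ))|
      = ∑ j ∈ 𝒜.J σ, |As.E (fun i => ((j (σ i) : Fin A.k) : ℕ))| := by
        refine sum_congr rfl fun j _ => ?_
        rw [← A.toAmp.E_relabel σ (fun l => ((j l : Fin A.k) : ℕ))]
        rfl
    _ ≤ ∑ j ∈ 𝒜.J σ, ∑ c ∈ (choices Gs.src Gs.tgt S).attach, |(As.term hSsub c.2).E (fun i => ((j (σ i) : Fin A.k) : ℕ))| := by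
        refine sum_le_sum fun j _ => ?_
        rw [As.E_eq_sum_terms hSsub]
        exact abs_sum_le_sum_abs _ _
    _ = ∑ c ∈ (choices Gs.src Gs.tgt S).attach, ∑ j ∈ 𝒜.J σ, |(As.term hSsub c.2).E (fun i => ((j (σ i) : Fin A.k) : ℕ))| :=
        sum_comm
    _ ≤ ∑ c ∈ (choices Gs.src Gs.tgt S).attach, ∑ j' ∈ Model.Mon m A.k, |(As.term hSsub c.2).E j'| := by
        refine sum_le_sum fun c _ => ?_
        calc ∑ j ∈ 𝒜.J σ, |(As.term hSsub c.2).E (fun i => ((j (σ i) : Fin A.k) : ℕ))|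
            = ∑ j' ∈ (𝒜.J σ).image (fun (j : Fin m → Fin A.k) (i : Fin m) => ((j (σ i) : Fin A.k) : ℕ)),
                |(As.term hSsub c.2).E j'| := by rw [sum_image hinj]
          _ ≤ ∑ j' ∈ Model.Mon m A.k, |(As.term hSsub c.2).E j'| := by
              apply sum_le_sum_of_subset_of_nonneg
              · intro j' hj'
                obtain ⟨j, hj, rfl⟩ := mem_image.1 hj'
                exact hmem j hj
              · intro j' _ _
                exact abs_nonneg _
    _ ≤ ∑ _c ∈ (choices Gs.src Gs.tgt S).attach,
          ((∏ l, A.C l) * ((1 + Esh G.toModel) ^ 2) ^ m) * unifConst215 G.d G.L m G.δ₁ * (A.cD ^ m * A.toAmp.pref) :=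
        sum_le_sum fun c _ => hterm c
    _ = _ := by rw [sum_const, card_attach, nsmul_eq_mul]

/-- **(1.33) for the total amplitude, with the (2.4) exception, print-strength readiness** (the sum over the orderings of
`sum_abs_E_le_ordering`): `|E(G′, {□(v)}, Φ′, A)| ≤ m!·(m+1)^m·(Π_l C_l)(1+e^{δ₁})^{2m}·unifConst215·cD^m·pref`.
[cite: Balaban1983Higgs3, Prop. 2.1 p.424] -/
theorem abs_Etot_le_except24 (A : IBPAmp₁ G)
    (hyp : ∀ σ : Equiv.Perm (Fin m), ∀ i, i ≤ m → ∀ b ∈ (relabelCounts G σ).toModel.reps i,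
      (relabelCounts G σ).toModel.Nontriv i b → Is24Block (relabelCounts G σ) i b ∨ 0 < (relabelCounts G σ).toModel.D i b) :
    |A.toAmp.Etot| ≤ (m.factorial : ℝ) * ((m + 1) ^ m : ℕ)
      * (((∏ l, A.C l) * ((1 + Esh G.toModel) ^ 2) ^ m) * unifConst215 G.d G.L m G.δ₁ * (A.cD ^ m * A.toAmp.pref)) := by
  classical
  set B := ((∏ l, A.C l) * ((1 + Esh G.toModel) ^ 2) ^ m) * unifConst215 G.d G.L m G.δ₁ * (A.cD ^ m * A.toAmp.pref)
    with hB
  have hB0 : 0 ≤ B := by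
    rw [hB]
    have h1 : 0 ≤ ∏ l, A.C l := prod_nonneg fun l _ => A.C_nonneg l
    have h2 : 0 ≤ unifConst215 G.d G.L m G.δ₁ := (unifConst215_pos G.d_pos G.two_le_L m G.δ₁_pos).le
    have h3 : 0 ≤ A.cD ^ m := pow_nonneg (le_trans zero_le_one A.one_le_cD) _
    have h4 := A.toAmp.pref_nonneg
    positivity
  rw [A.toAmp.Etot_eq_sum_E, B3.display27 (B3.Assignment.bySort m A.k)]
  calc |∑ σ : Equiv.Perm (Fin m), ∑ j ∈ (B3.Assignment.bySort m A.k).J σ, A.E (fun l => ((j l : Fin A.k) : ℕ))|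
      ≤ ∑ σ : Equiv.Perm (Fin m), |∑ j ∈ (B3.Assignment.bySort m A.k).J σ, A.E (fun l => ((j l : Fin A.k) : ℕ))| :=
        abs_sum_le_sum_abs _ _
    _ ≤ ∑ σ : Equiv.Perm (Fin m), ∑ j ∈ (B3.Assignment.bySort m A.k).J σ, |A.E (fun l => ((j l : Fin A.k) : ℕ))| :=
        sum_le_sum fun σ _ => abs_sum_le_sum_abs _ _
    _ ≤ ∑ σ : Equiv.Perm (Fin m), (((m + 1) ^ m : ℕ) : ℝ) * B := by
        refine sum_le_sum fun σ _ => (A.sum_abs_E_le_ordering (B3.Assignment.bySort m A.k) σ (hyp σ)).trans ?_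
        exact mul_le_mul_of_nonneg_right (by exact_mod_cast IBPAmp.card_choices_le _ _ _) hB0
    _ = (m.factorial : ℝ) * ((m + 1) ^ m : ℕ) * B := by
        rw [sum_const, card_univ, Fintype.card_perm, Fintype.card_fin, nsmul_eq_mul, mul_assoc]

/-! ## The graph-uniform constant -/

/-- **(1.33) for the total amplitude with the graph-UNIFORM constant `O(1)(n̄)`** of gen 4 (`unifO1x P mb = max 1 Σ_{m ≤ mb}
m!(m+1)^m(|Cmax|(1+e^{δ₁})²)^m·unifConst215·|CD|^m`): for an amplitude with the lattice constants of `P`, at most `mb` lines,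
kernel constants `≤ Cmax` and `cD ≤ CD`, all of whose components along every ordering have positive degree or are (2.4)-blocks,
`|E(G′)| ≤ unifO1x P mb · pref` — p. 421: *"The constant O(1) depends on α₀, n̄ … and is independent of ε, k, the domains Ω, Ω₁,
Ω₂, the vector field B̃"*. [cite: Balaban1983Higgs3, Prop. 1 p.421] -/
theorem abs_Etot_le_unifO1x (A : IBPAmp₁ G) (P : ParamsIBP) {mb : ℕ} (hd : G.d = P.d) (hL : G.L = P.L) (hδ : G.δ₁ = P.δ₁)
    (hm : m ≤ mb) (hCmax : ∀ l, A.C l ≤ P.Cmax) (hCD : A.cD ≤ P.CD)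
    (hyp : ∀ σ : Equiv.Perm (Fin m), ∀ i, i ≤ m → ∀ b ∈ (relabelCounts G σ).toModel.reps i,
      (relabelCounts G σ).toModel.Nontriv i b → Is24Block (relabelCounts G σ) i b ∨ 0 < (relabelCounts G σ).toModel.D i b) :
    |A.toAmp.Etot| ≤ unifO1x P mb * A.toAmp.pref := by
  classical
  have hmain := A.abs_Etot_le_except24 hyp
  have hE : Esh G.toModel = Real.exp (2 * (P.δ₁ / 2)) := by
    show Real.exp (2 * (G.δ₁ / 2)) = _
    rw [hδ]
  have hC : ∏ l, A.C l ≤ |P.Cmax| ^ m := by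
    calc ∏ l, A.C l ≤ ∏ _l : Fin m, |P.Cmax| :=
          prod_le_prod (fun l _ => A.C_nonneg l) fun l _ => (hCmax l).trans (le_abs_self _)
      _ = |P.Cmax| ^ m := by rw [prod_const, card_univ, Fintype.card_fin]
  have hcD : A.cD ^ m ≤ |P.CD| ^ m :=
    pow_le_pow_left₀ (le_trans zero_le_one A.one_le_cD) (hCD.trans (le_abs_self _)) _
  have hU0 : 0 ≤ unifConst215 P.d P.L m P.δ₁ := (unifConst215_pos P.d_pos P.two_le_L m P.δ₁_pos).le
  have hpref : 0 ≤ A.toAmp.pref := A.toAmp.pref_nonneg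
  have hK : (m.factorial : ℝ) * ((m + 1) ^ m : ℕ)
      * (((∏ l, A.C l) * ((1 + Esh G.toModel) ^ 2) ^ m) * unifConst215 G.d G.L m G.δ₁
        * (A.cD ^ m * A.toAmp.pref)) ≤ sizeTermX P m * A.toAmp.pref := by
    rw [hd, hL, hδ, hE]
    unfold sizeTermX
    have h1 : (∏ l, A.C l) * ((1 + Real.exp (2 * (P.δ₁ / 2))) ^ 2) ^ m
        ≤ |P.Cmax| ^ m * ((1 + Real.exp (2 * (P.δ₁ / 2))) ^ 2) ^ m :=
      mul_le_mul_of_nonneg_right hC (pow_nonneg (sq_nonneg _) _)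
    have h2 : (∏ l, A.C l) * ((1 + Real.exp (2 * (P.δ₁ / 2))) ^ 2) ^ m * unifConst215 P.d P.L m P.δ₁ * A.cD ^ m
        ≤ |P.Cmax| ^ m * ((1 + Real.exp (2 * (P.δ₁ / 2))) ^ 2) ^ m * unifConst215 P.d P.L m P.δ₁ * |P.CD| ^ m :=
      mul_le_mul (mul_le_mul_of_nonneg_right h1 hU0) hcD (pow_nonneg (le_trans zero_le_one A.one_le_cD) _)
        (mul_nonneg (mul_nonneg (pow_nonneg (abs_nonneg _) _) (pow_nonneg (sq_nonneg _) _)) hU0)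
    have hf : 0 ≤ (m.factorial : ℝ) * ((m + 1) ^ m : ℕ) := by positivity
    calc (m.factorial : ℝ) * ((m + 1) ^ m : ℕ)
          * (((∏ l, A.C l) * ((1 + Real.exp (2 * (P.δ₁ / 2))) ^ 2) ^ m) * unifConst215 P.d P.L m P.δ₁
            * (A.cD ^ m * A.toAmp.pref))
        = (m.factorial : ℝ) * ((m + 1) ^ m : ℕ)
          * (((∏ l, A.C l) * ((1 + Real.exp (2 * (P.δ₁ / 2))) ^ 2) ^ m) * unifConst215 P.d P.L m P.δ₁
            * A.cD ^ m) * A.toAmp.pref := by ring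
      _ ≤ (m.factorial : ℝ) * ((m + 1) ^ m : ℕ)
          * (|P.Cmax| ^ m * ((1 + Real.exp (2 * (P.δ₁ / 2))) ^ 2) ^ m * unifConst215 P.d P.L m P.δ₁ * |P.CD| ^ m)
          * A.toAmp.pref :=
          mul_le_mul_of_nonneg_right (mul_le_mul_of_nonneg_left h2 hf) hpref
      _ = _ := by ring
  exact (hmain.trans hK).trans (mul_le_mul_of_nonneg_right (sizeTermX_le_unifO1x P hm) hpref)

end IBPAmp₁

end Literature.MathematicalPhysics.QuantumFieldTheory.Balaban1983to89.B3Ineq213
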